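import Summits.ResolutionOfSingularities.ResolutionOfSingularities.Theorems.EquisingularLiftEquisingularLiftCubicSurfaceSingularPointsGeneralPosition
import Summits.ResolutionOfSingularities.ResolutionOfSingularities.Theorems.EquisingularLiftEquisingularLiftNatOrdinaryPointsMatrixResidual
import Summits.ResolutionOfSingularities.ResolutionOfSingularities.Theorems.EquisingularLiftEquisingularLiftOrdinaryPointsAnyChart
import HarnessLib

/-!
# [OURS] ★★★ CUBIC SURFACES WHOSE SINGULAR POINTS ARE ORDINARY: EL♮ IN EVERY CHARACTERISTIC; the residual of `EquisingularLiftNatThree`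
# (stmt-…-20148) RE-CUT BY NAME (the `A₁`-only cubic surfaces — and the cones over smooth plane cubics — are DONE)

[OURS · leafhand-res-equisingularlift-8 g0, 2026-08-31; cell `pub/decomp-res`; items stmt-…-20148 / -15660 (parent -20038)] AI-produced, weaker than expert
review; NOT a statement of any manuscript; nothing here proves resolution of singularities in positive characteristic.  DEF-FREE; no `sorry`; standard
axioms; ZERO named hypotheses.

lh7 g1 left the ordinary-points family discharged «granted the classical, unformalised fact that the `≤ 4` nodes of a cubic surface are in general
position».  That fact is now ✓ `CubicNodes.exists_normalized_matrix_of_singular` (this generation, ALL characteristics, classification-free), whence: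

* ★★★ `CubicNodes.elNatAt_of_cubic_ordinary` — `K = K̄` of characteristic `p`, `ι : H ↪ ℙ³_K` a closed immersion with `range ι = V₊(F)`, `F` a PRIME
  cubic form all of whose singular points are ORDINARY multiple points (at every singular `b` with `b_{c₀} = 1` the translated chart `F(x_{c₀}:=1)(y + b)`
  is `Φ + Ψ`, `Φ` a nonsingular form of degree `μ ≥ 1` — the tangent cone, closed-point Jacobian sense — and `Ψ ∈ (y)^{μ+1}`): `ELNatAt p K 3 H ι`.
  The submaximal-line cubics need no hypothesis check: they are covered by ✓ `SubmaxLine.elNatAt_of_linSubst_mem_pow` inside the proof.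
* ★ `CubicNodes.equisingularLiftNatThree_of_forall_elnatO_off_submaxLine_cubicOrdinary` — `Theses.EquisingularLift.EquisingularLiftNatThree` BY NAME
  from `ELNatConclusionO` at the non-regular prime-form surfaces of degree `e ≥ 3` with no submaximal line which are EITHER of degree `e ≥ 4` OR cubic
  with a NON-ORDINARY singular point (a witness `b, c₀` at which no ordinary datum exists).
* (companion file `…BlowupModelCubicSurfaceOrdinaryPoints`: regular blow-up models and the 15660 re-cut.)

Honest reading: closes no registered stub.  For cubic surfaces the residual of EL♮(3) is now exactly: normal cubic surfaces with a singular point whose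
tangent cone is a SINGULAR quadric/cubic cone (`A_{≥2}, D_4, D_5, E_6`, `Ẽ_6` cones over singular cubics are submaximal-line or reducible, and the
non-standard double points of characteristic `2`); degree `≥ 4` untouched; `n ≥ 4` untouched (⊇ summit).
-/

set_option linter.dupNamespace false -- mandated namespace `Summit.<Summit>.<Problem>` of this single-conjunct summit

noncomputable section

open CategoryTheory CategoryTheory.Limits AlgebraicGeometry TopologicalSpace
open MvPolynomial
open Literature.AlgebraicGeometry.Resolution
open Literature.AlgebraicGeometry.Motives Literature.AlgebraicGeometry.Motives.SmoothHypersurface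
open Literature.AlgebraicGeometry.Motives.ProjectiveSpace

namespace Summit.ResolutionOfSingularities.ResolutionOfSingularities.Cruxes.EquisingularLiftNat.Sections

namespace CubicNodes

variable {K : Type} [Field K]

/-- **From the `τ`-form «no submaximal line in any coordinates» to the matrix form** `F ∘ B ∉ (x₂, x₃)²` for all `B ∈ GL₄`. [folklore] -/
theorem not_mem_sq_of_forall_linSubst {F : MvPolynomial (Fin (3 + 1)) K} (hF : F.IsHomogeneous 3)
    (hsubmax : ∀ (τ τ' : Fin (3 + 1) → MvPolynomial (Fin (3 + 1)) K) (d : ℕ) (A B C : MvPolynomial (Fin 2) K),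
      (∀ i, (τ i).IsHomogeneous 1) → (∀ i, (τ' i).IsHomogeneous 1) → (∀ i, aeval τ (τ' i) = X i) → (∀ i, aeval τ' (τ i) = X i) →
      A.IsHomogeneous (d + 1) → B.IsHomogeneous (d + 1) → C.IsHomogeneous (d + 2) →
      aeval τ' F ≠ X 0 * rename (![2, 3] : Fin 2 → Fin (3 + 1)) A + X 1 * rename (![2, 3] : Fin 2 → Fin (3 + 1)) B +
        rename (![2, 3] : Fin 2 → Fin (3 + 1)) C) :
    ∀ B : Matrix (Fin 4) (Fin 4) K, IsUnit B.det → aeval B.toMvPolynomial F ∉ (Ideal.span {(X 2 : MvPolynomial (Fin 4) K), X 3}) ^ 2 := by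
  intro B hB hmem
  obtain ⟨A, B', C', hA, hB', hC', hshape⟩ :=
    SubmaxLine.exists_shape_of_mem_pow K (d := 1) (aeval B.toMvPolynomial F) (Literature.AlgebraicGeometry.ProjectiveSpace.IsHomogeneous.aeval_toMvPolynomial B hF) hmem
  exact hsubmax (B⁻¹).toMvPolynomial B.toMvPolynomial 1 A B' C' (Matrix.toMvPolynomial_isHomogeneous _) (Matrix.toMvPolynomial_isHomogeneous _)
    (MultiOrd.aeval_toMvPolynomial_inv_toMvPolynomial B hB) (MultiOrd.aeval_toMvPolynomial_toMvPolynomial_inv B hB) hA hB' hC' hshape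

/-- ★★★ **EL♮ FOR EVERY INTEGRAL CUBIC SURFACE WHOSE SINGULAR POINTS ARE ORDINARY MULTIPLE POINTS — every characteristic.**  `K = K̄` of
characteristic `p`; `ι : H ↪ ℙ³_K` a closed immersion with `range ι = V₊(F)`, `F` a prime cubic form; (ord) at every singular vector `b` (`F(b) = 0`,
`∇F(b) = 0`) normalised by `b_{c₀} = 1`, the chart `F(x_{c₀} := 1)` translated to `b` is `Φ + Ψ` with `Φ` a NONSINGULAR form of degree `μ ≥ 1` and
`Ψ ∈ (y)^{μ+1}`.  Then `Theorems.EquisingularLift.ELNatAt p K 3 H ι`.  (Submaximal-line cubics: ✓ `SubmaxLine.elNatAt_of_linSubst_mem_pow`; otherwise the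
singular points are `≤ 4` in general position, ✓ `exists_normalized_matrix_of_singular`, and ✓ `MultiOrd.elNatAt_of_ordinaryPoints_matrix₂` applies.)
[cite: Hartshorne1977, I Ex. 5.8, II Example 7.1.1] -/
theorem elNatAt_of_cubic_ordinary (p : ℕ) (hp : p.Prime) [CharP K p] [IsAlgClosed K]
    {H : Scheme.{0}} (ι : H ⟶ (projectiveSpace (1 + 1 + 1) K).left) [IsClosedImmersion ι]
    (F : MvPolynomial (Fin (1 + 1 + 1 + 1)) K) (hF : F.IsHomogeneous 3) (hprime : Prime F)
    (hrange : letI := MvPolynomial.gradedAlgebra (σ := Fin (1 + 1 + 1 + 1)) (R := K)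
      Set.range ι = {x : Proj (homogeneousSubmodule (Fin (1 + 1 + 1 + 1)) K) | F ∈ x.asHomogeneousIdeal})
    (hord : ∀ (b : Fin (1 + 2 + 1) → K) (c₀ : Fin (1 + 2 + 1)), b c₀ = 1 → eval b F = 0 → (∀ j, eval b (pderiv j F) = 0) →
      ∃ (μ : ℕ) (Φ Ψ : MvPolynomial (Fin (1 + 2)) K), 1 ≤ μ ∧ Φ.IsHomogeneous μ ∧ IsNonsingularForm K Φ ∧
        Ψ ∈ Ideal.span (Set.range (X : Fin (1 + 2) → MvPolynomial (Fin (1 + 2)) K)) ^ (μ + 1) ∧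
        aeval (fun j : Fin (1 + 2) => (X j : MvPolynomial (Fin (1 + 2)) K) + C (b (c₀.succAbove j))) (ProjectiveSpace.dehomogenize K c₀ F) = Φ + Ψ) :
    Theorems.EquisingularLift.ELNatAt p K (1 + 1 + 1) H ι := by
  classical
  by_cases hsm : ∃ B : Matrix (Fin 4) (Fin 4) K, IsUnit B.det ∧ aeval B.toMvPolynomial F ∈ (Ideal.span {(X 2 : MvPolynomial (Fin 4) K), X 3}) ^ 2
  · obtain ⟨B, hB, hmem⟩ := hsm
    exact SubmaxLine.elNatAt_of_linSubst_mem_pow (d := 1) p hp (B⁻¹).toMvPolynomial B.toMvPolynomial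
      (Matrix.toMvPolynomial_isHomogeneous _) (Matrix.toMvPolynomial_isHomogeneous _)
      (MultiOrd.aeval_toMvPolynomial_inv_toMvPolynomial B hB) (MultiOrd.aeval_toMvPolynomial_toMvPolynomial_inv B hB) ι F hprime
      (Literature.AlgebraicGeometry.ProjectiveSpace.IsHomogeneous.aeval_toMvPolynomial B hF) hmem hrange
  · push Not at hsm
    obtain ⟨B, S, c₀, hB, hS, hB1, hsing, hcov⟩ := exists_normalized_matrix_of_singular hF hprime hsm
    exact MultiOrd.elNatAt_of_ordinaryPoints_matrix₂ (m := 1) p hp ι F hF hprime hrange B hB S hS c₀ (fun c _ => hB1 c)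
      (fun c hc => hord (fun l => B l c) (c₀ c) (hB1 c) (hsing c hc).1 (hsing c hc).2) hcov

/-- ★ **`Theses.EquisingularLift.EquisingularLiftNatThree` (stmt-…-20148) RE-CUT BY NAME: off the submaximal-line surfaces AND off the cubic surfaces
with only ordinary singular points.**  `ELNatConclusionO` is needed only for the non-regular `H = V₊(F)`, `F` a prime form of degree `e ≥ 3` with no line
of multiplicity `e − 1` in any coordinates, which for `e = 3` moreover carries a singular vector `b` (`b_{c₀} = 1`) at which NO ordinary datum exists
(the translated chart at `b` is never `Φ + Ψ` with `Φ` a nonsingular form, closed-point sense). [OURS · lh8 · DEF-FREE · pure reduction]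
[cite: Hartshorne1977, I Ex. 5.8, I Ex. 5.12] -/
theorem equisingularLiftNatThree_of_forall_elnatO_off_submaxLine_cubicOrdinary
    (h : ∀ p : ℕ, p.Prime → ∀ (k : Type) [Field k] [CharP k p] [IsAlgClosed k] (H : Scheme.{0})
      (ι : H ⟶ (Literature.AlgebraicGeometry.Motives.projectiveSpace 3 k).left), IsClosedImmersion ι → IsIntegral H →
      (∀ y : (Literature.AlgebraicGeometry.Motives.projectiveSpace 3 k).left,
        ∃ U : (Literature.AlgebraicGeometry.Motives.projectiveSpace 3 k).left.affineOpens,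
          y ∈ (U : (Literature.AlgebraicGeometry.Motives.projectiveSpace 3 k).left.Opens) ∧ (ι.ker.ideal U).IsPrincipal) →
      ¬ Scheme.IsRegular H → ∀ (e : ℕ) (F : MvPolynomial (Fin (3 + 1)) k), 3 ≤ e → F.IsHomogeneous e → Prime F →
      (letI := MvPolynomial.gradedAlgebra (σ := Fin (3 + 1)) (R := k)
       Set.range ι = {x : Proj (homogeneousSubmodule (Fin (3 + 1)) k) | F ∈ x.asHomogeneousIdeal}) →
      (∀ (τ τ' : Fin (3 + 1) → MvPolynomial (Fin (3 + 1)) k) (d : ℕ) (A B C : MvPolynomial (Fin 2) k),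
        (∀ i, (τ i).IsHomogeneous 1) → (∀ i, (τ' i).IsHomogeneous 1) → (∀ i, aeval τ (τ' i) = X i) → (∀ i, aeval τ' (τ i) = X i) →
        A.IsHomogeneous (d + 1) → B.IsHomogeneous (d + 1) → C.IsHomogeneous (d + 2) →
        aeval τ' F ≠ X 0 * rename (![2, 3] : Fin 2 → Fin (3 + 1)) A + X 1 * rename (![2, 3] : Fin 2 → Fin (3 + 1)) B +
          rename (![2, 3] : Fin 2 → Fin (3 + 1)) C) →
      (e = 3 → ∃ (b : Fin (3 + 1) → k) (c₀ : Fin (3 + 1)), b c₀ = 1 ∧ eval b F = 0 ∧ (∀ j, eval b (pderiv j F) = 0) ∧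
        ∀ (μ : ℕ) (Φ Ψ : MvPolynomial (Fin 3) k), 1 ≤ μ → Φ.IsHomogeneous μ →
          (∀ z : Fin 3 → k, z ≠ 0 → eval z Φ = 0 → ∃ j, eval z (pderiv j Φ) ≠ 0) →
          Ψ ∈ Ideal.span (Set.range (X : Fin 3 → MvPolynomial (Fin 3) k)) ^ (μ + 1) →
          aeval (fun j : Fin 3 => (X j : MvPolynomial (Fin 3) k) + C (b (c₀.succAbove j))) (ProjectiveSpace.dehomogenize k c₀ F) ≠ Φ + Ψ) →
      ELNatConclusionO k 3 H ι) :
    Summit.ResolutionOfSingularities.ResolutionOfSingularities.Theses.EquisingularLift.EquisingularLiftNatThree := by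
  refine SubmaxLine.equisingularLiftNatThree_of_forall_elnatO_off_submaxLine ?_
  intro p hp k _ _ _ H ι hι hH hloc hreg e F he hF hprime hrange hsubmax
  by_cases hgood : e = 3 ∧ ∀ (b : Fin (3 + 1) → k) (c₀ : Fin (3 + 1)), b c₀ = 1 → eval b F = 0 → (∀ j, eval b (pderiv j F) = 0) →
      ∃ (μ : ℕ) (Φ Ψ : MvPolynomial (Fin 3) k), 1 ≤ μ ∧ Φ.IsHomogeneous μ ∧
        (∀ z : Fin 3 → k, z ≠ 0 → eval z Φ = 0 → ∃ j, eval z (pderiv j Φ) ≠ 0) ∧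
        Ψ ∈ Ideal.span (Set.range (X : Fin 3 → MvPolynomial (Fin 3) k)) ^ (μ + 1) ∧
        aeval (fun j : Fin 3 => (X j : MvPolynomial (Fin 3) k) + C (b (c₀.succAbove j))) (ProjectiveSpace.dehomogenize k c₀ F) = Φ + Ψ
  · obtain ⟨rfl, hall⟩ := hgood
    haveI := hι
    refine RouteCurrency.elnatO_of_elNatAt p hp k (1 + 1 + 1) H ι hι hH
      (elNatAt_of_cubic_ordinary (K := k) p hp ι F hF hprime hrange fun b c₀ hb1 hb0 hbd => ?_)
    obtain ⟨μ, Φ, Ψ, h1, h2, h3, h4, h5⟩ := hall b c₀ hb1 hb0 hbd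
    exact ⟨μ, Φ, Ψ, h1, h2, isNonsingularForm_of_forall_exists_eval_pderiv_ne_zero h3, h4, h5⟩
  · refine h p hp k H ι hι hH hloc hreg e F he hF hprime hrange hsubmax fun he3 => ?_
    have hno : ¬ ∀ (b : Fin (3 + 1) → k) (c₀ : Fin (3 + 1)), b c₀ = 1 → eval b F = 0 → (∀ j, eval b (pderiv j F) = 0) →
        ∃ (μ : ℕ) (Φ Ψ : MvPolynomial (Fin 3) k), 1 ≤ μ ∧ Φ.IsHomogeneous μ ∧
          (∀ z : Fin 3 → k, z ≠ 0 → eval z Φ = 0 → ∃ j, eval z (pderiv j Φ) ≠ 0) ∧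
          Ψ ∈ Ideal.span (Set.range (X : Fin 3 → MvPolynomial (Fin 3) k)) ^ (μ + 1) ∧
          aeval (fun j : Fin 3 => (X j : MvPolynomial (Fin 3) k) + C (b (c₀.succAbove j))) (ProjectiveSpace.dehomogenize k c₀ F) = Φ + Ψ :=
      fun hall => hgood ⟨he3, hall⟩
    push Not at hno
    obtain ⟨b, c₀, hb1, hb0, hbd, hnone⟩ := hno
    exact ⟨b, c₀, hb1, hb0, hbd, fun μ Φ Ψ h1 h2 h3 h4 => hnone μ Φ Ψ h1 h2 h3 h4⟩

end CubicNodes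

end Summit.ResolutionOfSingularities.ResolutionOfSingularities.Cruxes.EquisingularLiftNat.Sections

end
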